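import Summits.RiemannHypothesis.RiemannHypothesis.Theorems.SignConeKreinTuranPlattTrudgian210
import Summits.RiemannHypothesis.RiemannHypothesis.Theorems.SignConeKreinTuranSchurCert301

/-!
# Route SignCone — Krein–Turán rung, IX: the Platt–Trudgian instance beyond `x = 300` (cutoff `1427/500 > (log 300)/2`)

Support for the crux `SignConeInequality` (stmt-RiemannHypothesis-16301; plan `Cruxes/SignConeInequality/KREIN-TURAN-RUNG.md`).
As `SignConeKreinTuranPlattTrudgian210`, one rung up: `platt_trudgian_numerical_rh` implies Weil's functional with unit slack on
every test supported in `[-1427/500, 1427/500]` (`unitSlackWeil_log300_of_plattTrudgian`; `1427/500 = 2.854 > (log 300)/2 = 2.8519`),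
hence `SignConeInequality` / `SignConeOscillatory` for all cutoffs `a ≤ (log 300)/2` (`x = e^{2a} ≤ 300`) and `a ≤ 1427/500`.
Inputs: the kernel-checked Krein–Turán bound `Π(301, 571/100) ≤ 22` (`kreinTuranBound_301`), `b′ = 571/200`, plateau kernel
`⟨571/100, 2, []⟩` (`C_E ≤ 130`), `m = 9`, `h = 1/(4·10¹¹)`, `Y = 4·10¹⁰`, `B = 4.3723 + 520`, `τ′ ≤ 0.028`;
`τ′ + δ′(B + Π + 1) ≤ 0.64 ≤ 1`, credit `≥ 23.55 ≥ Π + 1 = 23`. CONDITIONAL on the named fact `platt_trudgian_numerical_rh`.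
This is where the present constants end: `Π + 1` has `≈ 0.5` of credit left (`N ≈ 330`); the next rungs need a larger `Y`
(higher `m`, or a larger verified height `H`), since the credit grows like `log Y` while `Π(N) ≈ 1.15 √N`.
-/

noncomputable section

-- `Summit.RiemannHypothesis.RiemannHypothesis.…` repeats a namespace component by design (D-0017 layout).
set_option linter.dupNamespace false

open scoped BigOperators ComplexConjugate Real Topology ArithmeticFunction.vonMangoldt
open Complex MeasureTheory Set Filter

namespace Summit.RiemannHypothesis.RiemannHypothesis.Theorems.SignCone

open Literature.NumberTheory.LFunctions Literature.Analysis.SpecialFunctions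
open Literature.NumberTheory.LFunctions.ZetaZeroTails (tailInvImSq tailInvImSq_le tailInvImSq_nonneg)
open Literature.Analysis.ValidatedNumerics.Numerics

/-! ### Data and numerical lemmas -/

/-- The plateau kernel `χ ≡ 1` on `[0, 571/100]`, linear to `0` on `[571/100, 771/100]`. [folklore] -/
def ktKernel3 : PWKernel := ⟨571 / 100, 2, []⟩

/-- `e^{1427/500} ≤ 17.36`. [folklore] -/
theorem exp_2854_le : Real.exp (1427 / 500) ≤ 1736 / 100 := by
  have := exp_le_of_expFI (q := 1427 / 500) (r := 1736 / 100) (by decide +kernel)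
  push_cast at this; exact this

/-- `e^{771/200} ≤ 47.24`. [folklore] -/
theorem exp_3855_le : Real.exp (771 / 200) ≤ 4724 / 100 := by
  have := exp_le_of_expFI (q := 771 / 200) (r := 4724 / 100) (by decide +kernel)
  push_cast at this; exact this

/-- `e^{571/200} ≤ 17.38`. [folklore] -/
theorem exp_2855_le : Real.exp (571 / 200) ≤ 1738 / 100 := by
  have := exp_le_of_expFI (q := 571 / 200) (r := 1738 / 100) (by decide +kernel)
  push_cast at this; exact this

/-- `e^{571/100} < 302`. [folklore] -/
theorem exp_571_lt : Real.exp (571 / 100) < 302 := by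
  have := exp_le_of_expFI (q := 571 / 100) (r := 3019 / 10) (by decide +kernel)
  push_cast at this; linarith

/-- `300 ≤ e^{1427/250}`, i.e. `(log 300)/2 ≤ 1427/500`. [folklore] -/
theorem exp_5708_ge : (300 : ℝ) ≤ Real.exp (1427 / 250) := by
  have := exp_ge_of_expFI (q := 1427 / 250) (r := 300) (by decide +kernel)
  push_cast at this; exact this

/-- `(log 300)/2 ≤ 1427/500`. [folklore] -/
theorem log_300_half_le : Real.log 300 / 2 ≤ 1427 / 500 := by
  rw [div_le_iff₀ (by norm_num : (0 : ℝ) < 2), Real.log_le_iff_le_exp (by norm_num)]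
  have := exp_5708_ge
  rw [show (1427 / 500 : ℝ) * 2 = 1427 / 250 by norm_num]
  exact this

/-- `C_E ≤ 130` for the plateau kernel. [folklore] -/
theorem decayConst_ktKernel3_le : ktKernel3.decayConst ≤ 130 := by
  unfold PWKernel.decayConst PWKernel.K PWKernel.knot
  simp only [ktKernel3, List.length_nil, zero_add, Finset.Ico_self, Finset.sum_empty, add_zero]
  push_cast
  have h1 := exp_3855_le
  have h2 := exp_2855_le
  norm_num at h1 h2 ⊢
  linarith

/-! ### The instance -/

/-- **Weil's functional with unit slack at cutoff `1427/500 (> (log 300)/2)`, from Platt–Trudgian, Krein–Turán form**: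
`platt_trudgian_numerical_rh → ∀ g ∈ C_c^∞[-1427/500, 1427/500], −‖g‖₂² ≤ Re W(g ⋆ g̃)`. CONDITIONAL on the named hypothesis.
[cite: PlattTrudgianBLMS2021, Theorem 1] -/
theorem unitSlackWeil_log300_of_plattTrudgian (hPT : platt_trudgian_numerical_rh) :
    ∀ g : ℝ → ℂ, IsWeilTest g → tsupport g ⊆ Icc (-(1427 / 500 : ℝ)) (1427 / 500) →
      -weilNorm2Sq g ≤ (weilFunctional (weilConv g (weilReflect g))).re := by
  intro g hg hs
  have hRH : RiemannHypothesisInStripUpTo 3000175332800 := platt_trudgian_numerical_rh_iff_inStrip.1 hPT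
  -- the arch density and its bounds
  have hdh : (0 : ℚ) < ktKernel3.h := by norm_num [ktKernel3]
  have hdL : ((ktKernel3.L : ℚ) : ℝ) = 2 * (571 / 200) := by norm_num [ktKernel3]
  have hdL0 : (0 : ℚ) ≤ ktKernel3.L := by norm_num [ktKernel3]
  have hN : Real.exp (2 * (571 / 200)) < (301 : ℕ) + 1 := by
    rw [show (2 : ℝ) * (571 / 200) = 571 / 100 by norm_num]; push_cast; linarith [exp_571_lt]
  have hA := isArchDensity_archDensity hdh hdL hN
  have hC := decayConst_ktKernel3_le
  have hLB : ∀ y : ℝ, |y| ≤ 4 * (10 : ℝ) ^ 10 → -(43723 / 10000 + 4 * 130 : ℝ) ≤ archDensity ktKernel3 y := by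
    intro y _
    have := archDensity_lowBand hdL0 hdh y
    norm_num at this ⊢
    linarith
  have hHF : ∀ y : ℝ, 4 * (10 : ℝ) ^ 10 < |y| → (22 : ℝ) + 1 ≤ archDensity ktKernel3 y := by
    intro y hy
    have h := archDensity_highFreq hdL0 hdh (Y := 4 * (10 : ℝ) ^ 10) (by norm_num) hy
    refine le_trans ?_ h
    have hlog : (237 / 10 : ℝ) ≤ Real.log (4 * (10 : ℝ) ^ 10 / 2) := by
      rw [Real.le_log_iff_exp_le (by norm_num)]
      exact exp_237_10_le.trans (by norm_num)
    have hpi := Real.pi_lt_d2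
    have hlpi := Real.log_pi_le
    have hE : ktKernel3.decayConst / (1 / 4 + (4 * (10 : ℝ) ^ 10) ^ 2) ≤ 130 / (1 / 4 + (4 * (10 : ℝ) ^ 10) ^ 2) :=
      div_le_div_of_nonneg_right hC (by positivity)
    have hpi2 : π / (2 * (4 * (10 : ℝ) ^ 10)) ≤ 3.15 / (2 * (4 * (10 : ℝ) ^ 10)) :=
      div_le_div_of_nonneg_right hpi.le (by positivity)
    norm_num at hE hpi2 ⊢
    linarith
  -- the Krein–Turán bound
  have hKT : ∀ v : ℝ → ℂ, IsWeilTest v → tsupport v ⊆ Icc (-(571 / 200 : ℝ)) (571 / 200) →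
      ∑ n ∈ Finset.range (301 + 1), 2 * Λ n / Real.sqrt n * ((weilConv v (weilReflect v)) (Real.log n)).re ≤
        22 * weilNorm2Sq v := by
    intro v hv hvs
    exact kreinTuranBound_301 v hv (by rw [show (571 / 100 / 2 : ℝ) = 571 / 200 by norm_num]; exact hvs)
  -- numerical side conditions
  have hcosh : Real.cosh ((1 : ℝ) / (4 * 10 ^ 11) / 2) ≤ 10001 / 10000 := by
    refine (cosh_le_one_add_sq (by rw [abs_of_pos (by positivity)]; norm_num)).trans (by norm_num)
  have hHh : Real.cosh ((1 : ℝ) / (4 * 10 ^ 11) / 2) ≤ (1 : ℝ) / (4 * 10 ^ 11) * 3000175332800 :=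
    hcosh.trans (by norm_num)
  have hτ : 6 * (1427 / 500 : ℝ) * Real.exp (1427 / 500) *
      (Real.cosh ((1 : ℝ) / (4 * 10 ^ 11) / 2) / ((1 : ℝ) / (4 * 10 ^ 11))) ^ (2 * (9 + 1)) /
        (3000175332800 : ℝ) ^ (2 * (9 + 1) - 2) * ((986 / 100) / 3000175332800) ≤ 28 / 1000 := by
    have he := exp_2854_le
    have hP : 0 ≤ (Real.cosh ((1 : ℝ) / (4 * 10 ^ 11) / 2) / ((1 : ℝ) / (4 * 10 ^ 11))) ^ (2 * (9 + 1)) := by positivity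
    calc 6 * (1427 / 500 : ℝ) * Real.exp (1427 / 500) *
          (Real.cosh ((1 : ℝ) / (4 * 10 ^ 11) / 2) / ((1 : ℝ) / (4 * 10 ^ 11))) ^ (2 * (9 + 1)) /
            (3000175332800 : ℝ) ^ (2 * (9 + 1) - 2) * ((986 / 100) / 3000175332800)
        ≤ 6 * (1427 / 500 : ℝ) * (1736 / 100) * ((10001 / 10000 : ℝ) / ((1 : ℝ) / (4 * 10 ^ 11))) ^ (2 * (9 + 1)) /
            (3000175332800 : ℝ) ^ (2 * (9 + 1) - 2) * ((986 / 100) / 3000175332800) := by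
          gcongr
      _ ≤ 28 / 1000 := by norm_num
  suffices h0 : 0 ≤ (weilFunctional (weilConv g (weilReflect g))).re + weilNorm2Sq g by linarith
  refine unitSlackWeil_of_rhUpTo_kreinTuran hg (b := 1427 / 500) (by norm_num) hs (h := (1 : ℝ) / (4 * 10 ^ 11))
    (by positivity) (m := 9) (b' := 571 / 200) (by norm_num) (H := 3000175332800) (Θ := (986 / 100) / 3000175332800)
    (by norm_num) hRH tailInvImSq_plattTrudgian_le hHh hA (Pup := 22) (by norm_num) hKT (Y := 4 * (10 : ℝ) ^ 10)
    (B := 43723 / 10000 + 4 * 130) (by positivity) (by norm_num) (by norm_num) hHF hLB ?_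
  norm_num at hτ ⊢
  linarith

/-- **`SignConeOscillatory` for all cutoffs `a ≤ 1427/500`, conditional on Platt–Trudgian** (body verbatim over Mathlib
primitives; honest weights, unit slack from `unitSlackWeil_log300_of_plattTrudgian`). [cite: PlattTrudgianBLMS2021, Theorem 1] -/
theorem signConeOscillatory_upTo_2854_of_plattTrudgian (hPT : platt_trudgian_numerical_rh) :
    ∀ a : ℝ, 0 < a → a ≤ 1427 / 500 → ∀ (k : ℕ) (g : Fin k → ℝ → ℂ), (∀ i, (ContDiff ℝ ((⊤ : ℕ∞) : WithTop ℕ∞) (g i) ∧ HasCompactSupport (g i)) ∧ tsupport (g i) ⊆ Set.Icc (-a) a) → let F : ℝ → ℂ := fun t => ∑ i, MeasureTheory.convolution (g i) (fun u => (starRingEnd ℂ) ((g i) (-u))) (ContinuousLinearMap.mul ℂ ℂ) MeasureTheory.MeasureSpace.volume t; (∀ n : ℕ, 2 ≤ n → 0 ≤ (F (Real.log n)).re) → (∃ t : ℝ, Real.log 2 ≤ |t| ∧ (F t).re < 0) → let M : ℂ → ℂ := fun s => ∫ u : ℝ, F u * Complex.exp ((s - 1 / 2) * u); -(F 0).re ≤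 (M 0 + M 1 + ((1 / (2 * Real.pi) : ℂ) * (∫ t : ℝ, M (1 / 2 + t * Complex.I) * ((Complex.digamma (1 / 4 + t / 2 * Complex.I)).re : ℂ)) - F 0 * (Real.log Real.pi : ℂ))).re := by
  refine signConeOscillatory_upTo_of_fakeWeight_unitSlack (b := 1427 / 500) (c := fun n => Λ n)
    (fun n => ArithmeticFunction.vonMangoldt_nonneg) fun g hg hs => ?_
  have h := unitSlackWeil_log300_of_plattTrudgian hPT g hg hs
  unfold weilFunctional weilPrimeTerm at h
  unfold weilNorm2Sq at h
  rw [show weilPolarTerm (weilConv g (weilReflect g)) + weilArchTerm (weilConv g (weilReflect g)) -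
      ∑' n : ℕ, ((Λ n : ℝ) : ℂ) / (Real.sqrt n : ℂ) * (weilConv g (weilReflect g) (Real.log n) +
        weilConv g (weilReflect g) (-Real.log n)) =
      weilPolarTerm (weilConv g (weilReflect g)) - ∑' n : ℕ, ((Λ n : ℝ) : ℂ) / (Real.sqrt n : ℂ) *
        (weilConv g (weilReflect g) (Real.log n) + weilConv g (weilReflect g) (-Real.log n)) +
          weilArchTerm (weilConv g (weilReflect g)) by ring]
  exact h

/-- **`SignConeInequality` for all cutoffs `a ≤ 1427/500`, conditional on Platt–Trudgian** (the route's target body, restricted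
to `a ≤ 1427/500 = 2.854`). [cite: PlattTrudgianBLMS2021, Theorem 1] -/
theorem signConeInequality_upTo_2854_of_plattTrudgian (hPT : platt_trudgian_numerical_rh) :
    ∀ a : ℝ, 0 < a → a ≤ 1427 / 500 → ∀ (k : ℕ) (g : Fin k → ℝ → ℂ), (∀ i, (ContDiff ℝ ((⊤ : ℕ∞) : WithTop ℕ∞) (g i) ∧ HasCompactSupport (g i)) ∧ tsupport (g i) ⊆ Set.Icc (-a) a) → let F : ℝ → ℂ := fun t => ∑ i, MeasureTheory.convolution (g i) (fun u => (starRingEnd ℂ) ((g i) (-u))) (ContinuousLinearMap.mul ℂ ℂ) MeasureTheory.MeasureSpace.volume t; (∀ n : ℕ, 2 ≤ n → 0 ≤ (F (Real.log n)).re) → let M : ℂ → ℂ := fun s => ∫ u : ℝ, F u * Complex.exp ((s - 1 / 2) * u); -(F 0).re ≤ (M 0 + M 1 + ((1 / (2 * Real.pi) : ℂ) * (∫ t : ℝ, M (1 / 2 + t * Complex.I) * ((Complex.digamma (1 / 4 + t / 2 * Complex.I)).re : ℂ)) - F 0 * (Real.log Real.pi : ℂ))).re := by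
  intro a _ha hab k g hg F hn M
  have hW : ∀ g : ℝ → ℂ, IsWeilTest g → tsupport g ⊆ Icc (-(1427 / 500 : ℝ)) (1427 / 500) →
      -(∫ t, ‖g t‖ ^ 2) ≤ (weilPolarTerm (weilConv g (weilReflect g)) + weilArchTerm (weilConv g (weilReflect g)) -
        ∑' n : ℕ, (((fun n => Λ n) n : ℝ) : ℂ) / (Real.sqrt n : ℂ) *
          (weilConv g (weilReflect g) (Real.log n) + weilConv g (weilReflect g) (-Real.log n))).re := by
    intro g hg hs
    have h := unitSlackWeil_log300_of_plattTrudgian hPT g hg hs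
    unfold weilFunctional weilPrimeTerm at h
    unfold weilNorm2Sq at h
    rw [show weilPolarTerm (weilConv g (weilReflect g)) + weilArchTerm (weilConv g (weilReflect g)) -
        ∑' n : ℕ, (((fun n => Λ n) n : ℝ) : ℂ) / (Real.sqrt n : ℂ) * (weilConv g (weilReflect g) (Real.log n) +
          weilConv g (weilReflect g) (-Real.log n)) =
        weilPolarTerm (weilConv g (weilReflect g)) - ∑' n : ℕ, ((Λ n : ℝ) : ℂ) / (Real.sqrt n : ℂ) *
          (weilConv g (weilReflect g) (Real.log n) + weilConv g (weilReflect g) (-Real.log n)) +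
            weilArchTerm (weilConv g (weilReflect g)) by ring]
    exact h
  exact neg_re_apply_zero_le_re_weilArchPolar_of_fakeWeight_unitSlack (b := 1427 / 500) (c := fun n => Λ n)
    (fun n => ArithmeticFunction.vonMangoldt_nonneg) hW (g := g) (F := F) rfl (fun i => (hg i).1)
    (fun i => (hg i).2.trans (Icc_subset_Icc (neg_le_neg hab) hab)) hn

/-- **`SignConeInequality` up to `a ≤ (log 300)/2` (`x = e^{2a} ≤ 300`), conditional on Platt–Trudgian** —
one rung above the 2001 benchmark `x = 210`, fact-conditional.
[cite: PlattTrudgianBLMS2021, Theorem 1] -/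
theorem signConeInequality_upTo_log300half_of_plattTrudgian (hPT : platt_trudgian_numerical_rh) :
    ∀ a : ℝ, 0 < a → a ≤ Real.log 300 / 2 → ∀ (k : ℕ) (g : Fin k → ℝ → ℂ), (∀ i, (ContDiff ℝ ((⊤ : ℕ∞) : WithTop ℕ∞) (g i) ∧ HasCompactSupport (g i)) ∧ tsupport (g i) ⊆ Set.Icc (-a) a) → let F : ℝ → ℂ := fun t => ∑ i, MeasureTheory.convolution (g i) (fun u => (starRingEnd ℂ) ((g i) (-u))) (ContinuousLinearMap.mul ℂ ℂ) MeasureTheory.MeasureSpace.volume t; (∀ n : ℕ, 2 ≤ n → 0 ≤ (F (Real.log n)).re) → let M : ℂ → ℂ := fun s => ∫ u : ℝ, F u * Complex.exp ((s - 1 / 2) * u); -(F 0).re ≤ (M 0 + M 1 + ((1 / (2 * Real.pi) : ℂ) * (∫ t : ℝ, M (1 / 2 + t * Complex.I) * ((Complex.digamma (1 / 4 + t / 2 * Complex.I)).re : ℂ)) - F 0 * (Real.log Real.pi : ℂ))).re :=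
  fun a ha hab => signConeInequality_upTo_2854_of_plattTrudgian hPT a ha (hab.trans log_300_half_le)

/-- **`SignConeOscillatory` up to `a ≤ (log 300)/2`, conditional on Platt–Trudgian.** [cite: PlattTrudgianBLMS2021, Theorem 1] -/
theorem signConeOscillatory_upTo_log300half_of_plattTrudgian (hPT : platt_trudgian_numerical_rh) :
    ∀ a : ℝ, 0 < a → a ≤ Real.log 300 / 2 → ∀ (k : ℕ) (g : Fin k → ℝ → ℂ), (∀ i, (ContDiff ℝ ((⊤ : ℕ∞) : WithTop ℕ∞) (g i) ∧ HasCompactSupport (g i)) ∧ tsupport (g i) ⊆ Set.Icc (-a) a) → let F : ℝ → ℂ := fun t => ∑ i, MeasureTheory.convolution (g i) (fun u => (starRingEnd ℂ) ((g i) (-u))) (ContinuousLinearMap.mul ℂ ℂ) MeasureTheory.MeasureSpace.volume t; (∀ n : ℕ, 2 ≤ n → 0 ≤ (F (Real.log n)).re) → (∃ t : ℝ, Real.log 2 ≤ |t| ∧ (F t).re < 0) → let M : ℂ → ℂ := fun s => ∫ u : ℝ, F u * Complex.exp ((s - 1 / 2) * u); -(F 0).re ≤ (M 0 + M 1 + ((1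 / (2 * Real.pi) : ℂ) * (∫ t : ℝ, M (1 / 2 + t * Complex.I) * ((Complex.digamma (1 / 4 + t / 2 * Complex.I)).re : ℂ)) - F 0 * (Real.log Real.pi : ℂ))).re :=
  fun a ha hab => signConeOscillatory_upTo_2854_of_plattTrudgian hPT a ha (hab.trans log_300_half_le)

end Summit.RiemannHypothesis.RiemannHypothesis.Theorems.SignCone

end
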